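import Literature.AnabelianGeometry.EtaleTheta.Discharge.Sec2YdduuTranslates
import Literature.AnabelianGeometry.EtaleTheta.Discharge.Sec1LogUddNotKummer
import HarnessLib

/-!
# [EtTh] §2: the `Z`-translates of a theta class restricted to `Π^tp_Ÿ̲̲` are non-torsion — binder `hL` DISCHARGED

Mochizuki, *The étale theta function …*, Publ. RIMS **45** (2009) [EtTh], Prop. 1.5 (ii)–(iii), PRIMS PDF p. 23;
§2 Def. 2.7 p. 41 (the covering `Ÿ̲̲ → Ÿ`) [cite: MochizukiEtTh2009, Prop 1.5 (iii) p.23]. Cell abc-iut, PROOF-ONLY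
junction file (seat abc-iut-w4-d010 gen 5, node IUTchII:Prop2.2(ii) assembler lineage; NO definitions, NO
`Prop`-valued facts, nothing landed is edited).

abc-iut-L2-t8's `Sec2YdduuTranslates` (p-lineage of `not_isOfFinOrder_res_conj_zpow_div_GtpYdduu`,
`not_isOfFinOrder_comap_conj_zpow_div_of_GtpYdduu_le`, `not_isOfFinOrder_comap_conj_zpow_etaDd_div`) proved the
non-torsion of the `Π^tp_Ÿ̲̲`-restricted `Z`-translates `(γᵏ · x) · x⁻¹` of a theta class CONDITIONALLY on the binder
`hL : ∀ n : ℤ, log(Ü)ⁿ ∈ F̈² → n = 0` (plan/GAP-LEDGER G-L2t1-1 — half of print's «`F̈¹/F̈² = Ẑ · log(Ü)`»,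
Prop. 1.5 (ii)). abc-iut-L2-t7's `Sec1LogUddNotKummer` (`EtaleThetaData.logUdd_zpow_mem_Fdd2_imp`) DERIVED `hL`
from `Compat`, the vacuity guard `IsEtThOrigin`, `Prop15iii` and `Prop15ii` — all four of which these theorems
ALREADY take. This file substitutes the derivation: the three statements below are the landed ones with the
binder `hL` REMOVED and every other hypothesis byte-identical (the §2 analogue of abc-iut-L2-t1's
`Sec1TranslatesNonTorsionOfOrigin`). Nothing new is asserted about [EtTh]; [EtTh] is refereed and undisputed;
typed ≠ proved; no side taken on [IUTchIII] Cor. 3.12.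
-/

noncomputable section

namespace Literature.AnabelianGeometry.EtaleTheta

open Literature.AnabelianGeometry.SemiGraphs

namespace ThetaSetting

variable {p : ℕ} [Fact p.Prime] {D : ThetaSetting p}

namespace EtaleThetaData.DoubleUnderline

variable {E : D.EtaleThetaData} {l : ℕ} (C : E.DoubleUnderline l)

/-- **Non-torsion on `Π^tp_Ÿ̲̲`, binder `hL` discharged** ([EtTh] Prop. 1.4 (i)/(iii) + Prop. 1.5 (ii)/(iii) at the
class level, restricted to the covering `Ÿ̲̲ → Ÿ` of §2): for a theta class `x ∈ O^×_K̈ · η̈^Θ`, `γ ∈ Π^tp_X` with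
`γ ↦ a ≠ 0` in `Z` and `k ≠ 0`, the restriction to `Π^tp_Ÿ̲̲ = Π^tp_Ÿ ∩ Π^tp_X̲̲` of `(γᵏ · x) · x⁻¹` is NOT a torsion
class — under `Compat`, `IsEtThOrigin` and the named facts `Prop15iii`, `Prop15ii` ONLY
(`not_isOfFinOrder_res_conj_zpow_div_GtpYdduu` with `hL := logUdd_zpow_mem_Fdd2_imp`).
[cite: MochizukiEtTh2009, Prop 1.5 (iii) p.23] -/
theorem not_isOfFinOrder_res_conj_zpow_div_GtpYdduu_of_origin (hC : D.Compat) (hO : D.IsEtThOrigin)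
    (h15 : Prop15iii E hC) (h15ii : Prop15ii E.toKummerData hC)
    {γ : D.PiTemp} (hγ : D.toZ γ ≠ 1) {k : ℤ} (hk : k ≠ 0) {x : D.H1 D.GtpYdd}
    (hx : x ∈ E.thetaClasses) :
    haveI := hC.GtpYdd_normal
    ¬ IsOfFinOrder (ContH1.res D.toTheta D.DeltaTheta (inf_le_left : C.GtpYdduu ≤ D.GtpYdd)
      (ContH1.conj D.toTheta D.DeltaTheta (γ ^ k) x * x⁻¹)) :=
  C.not_isOfFinOrder_res_conj_zpow_div_GtpYdduu hC hO h15 h15ii (E.logUdd_zpow_mem_Fdd2_imp hC hO h15 h15ii)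
    hγ hk hx

/-- **Pulled-back form, binder `hL` discharged** (the shape consumed by the [IUTchII] model, where
`Π^tp_Ÿ̲̲ = Π_Ÿ(Π) ⊆ Π^tp_X̲̲ ↪ Π^tp_X` and classes are pulled back along a continuous `ι` with
`Π^tp_Ÿ̲̲ ⊆ ι(H₀) ⊆ Π^tp_Ÿ`): the pull-back to `H₀` of `(γᵏ · x) · x⁻¹` is NOT a torsion class, under `Compat`,
`IsEtThOrigin`, `Prop15iii`, `Prop15ii` only. [cite: MochizukiEtTh2009, Prop 1.5 (iii) p.23] -/
theorem not_isOfFinOrder_comap_conj_zpow_div_of_GtpYdduu_le_of_origin (hC : D.Compat) (hO : D.IsEtThOrigin)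
    (h15 : Prop15iii E hC) (h15ii : Prop15ii E.toKummerData hC)
    {G₀ : Type*} [Group G₀] [TopologicalSpace G₀] {ι : G₀ →* D.PiTemp} (hι : Continuous ι)
    {H₀ : Subgroup G₀} (hH₀ : H₀.map ι ≤ D.GtpYdd) (hle : C.GtpYdduu ≤ H₀.map ι)
    {γ : D.PiTemp} (hγ : D.toZ γ ≠ 1) {k : ℤ} (hk : k ≠ 0) {x : D.H1 D.GtpYdd}
    (hx : x ∈ E.thetaClasses) :
    haveI := hC.GtpYdd_normal
    ¬ IsOfFinOrder (ContH1.comap D.toTheta D.DeltaTheta ι hι hH₀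
      (ContH1.conj D.toTheta D.DeltaTheta (γ ^ k) x * x⁻¹)) :=
  C.not_isOfFinOrder_comap_conj_zpow_div_of_GtpYdduu_le hC hO h15 h15ii
    (E.logUdd_zpow_mem_Fdd2_imp hC hO h15 h15ii) hι hH₀ hle hγ hk hx

/-- The same for the étale theta class `x := η̈^Θ` itself and a generator `γ ∈ Π^tp_X̲̲` of `Gal(Y̲̲/X̲̲) ≅ ℤ`,
binder `hL` discharged — the hypothesis `h14` of abc-iut-L2-t8's `EtaleThetaDataOfSetting.hfree_of_etaDd_free`
up to the identification `ι(H₀) ⊇ Π^tp_Ÿ̲̲`, now modulo `Compat`, `IsEtThOrigin`, `Prop15iii`, `Prop15ii` only.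
[cite: MochizukiEtTh2009, Prop 1.5 (iii) p.23] -/
theorem not_isOfFinOrder_comap_conj_zpow_etaDd_div_of_origin (hC : D.Compat) (hO : D.IsEtThOrigin)
    (h15 : Prop15iii E hC) (h15ii : Prop15ii E.toKummerData hC)
    {G₀ : Type*} [Group G₀] [TopologicalSpace G₀] {ι : G₀ →* D.PiTemp} (hι : Continuous ι)
    {H₀ : Subgroup G₀} (hH₀ : H₀.map ι ≤ D.GtpYdd) (hle : C.GtpYdduu ≤ H₀.map ι)
    {γ : C.Huu} (hγ : C.toLZ γ = Multiplicative.ofAdd 1) {k : ℤ} (hk : k ≠ 0) :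
    haveI := hC.GtpYdd_normal
    ¬ IsOfFinOrder (ContH1.comap D.toTheta D.DeltaTheta ι hι hH₀
      (ContH1.conj D.toTheta D.DeltaTheta ((γ : D.PiTemp) ^ k) E.etaDd * E.etaDd⁻¹)) :=
  C.not_isOfFinOrder_comap_conj_zpow_etaDd_div hC hO h15 h15ii (E.logUdd_zpow_mem_Fdd2_imp hC hO h15 h15ii)
    hι hH₀ hle hγ hk

end EtaleThetaData.DoubleUnderline

end ThetaSetting

end Literature.AnabelianGeometry.EtaleTheta

end
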